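import Literature.NumberTheory.Automorphic.LanglandsShelstad1987.KeyLemmasI
import Literature.NumberTheory.Automorphic.LanglandsShelstad1987.KeyLemmasII
import Mathlib.GroupTheory.SemidirectProduct
import HarnessLib

/-!
# Langlands–Shelstad (1987), (2.6) «A second application»: the admissible embeddings `ξ : ᴸT → ᴸG` attached to
# χ-data — Lemma 2.6.A and the remarks (2.6.1)–(2.6.5), over the carriers of `Defs` ∕ `KeyLemmasI` ∕ `KeyLemmasII`

R. P. Langlands, D. Shelstad, *On the definition of transfer factors*, Math. Ann. **278** (1987) 219–271
[LanglandsShelstad1987]; IAS reissue (held as `paper:doi-10-1007-bf01458070`) pp. 22–25; every pin «(reissue p. N)» is a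
page of that file.  Squad TN (HCML «GO 500», SPLIT-v1 6bf6eba45b565d8c row TN-t02); topic
`NumberTheory/Automorphic/LanglandsShelstad1987`, namespace
`Literature.NumberTheory.Automorphic.LanglandsShelstad1987.KeyLemmasII` (continued: this is the (2.6) third of the deal
«KeyLemmasII», split off to respect the 400-line rule).  STATEMENTS ONLY: every `def`/`structure` has a body; no theorem,
no `sorry`, no `axiom`, no `instance`, no `notation`.

## Design note: the dual group is an abstract group with `Γ`-action; the Weil group an abstract extension
(2.6) needs `Ĝ` with a `Γ`-splitting `(ℬ, 𝒯, {X_{α^∨}})`, the torus `𝒯 ⊂ Ĝ` dual to `T` (`𝒯 = ℂ^× ⊗ X`,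
`X = X^*(T) = X_*(𝒯)`), its normaliser, and the elements `n(ω) ∈ Norm(𝒯, Ĝ)` of (2.1).  The tree's ★
`Automorphic.LGroupData` fixes `Ĝ ≤ GL_N(ℂ)` with a `Γ_F`-action but has no maximal torus ∕ Weyl group ∕ `n(ω)` API (and ★
`KeyLemmasI.Lemma_2_1_A` is, for the same reason, a predicate on a GIVEN Tits section); following the squad policy («a
notion Lean lacks ⇒ ONE `structure` interface, book definition cited, never an axiom») the (2.6) items are stated on an
explicit `DualTorusEmbedding` (a group `Ĝ` with `Γ` acting by automorphisms, `ι : 𝒯 → Ĝ`, and the map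
`σ ↦ n(ω_T(σ))`), whose printed properties are the predicates `IsTransport` and `IsWeylCocycle` (the latter IS ★
`KeyLemmasI.Lemma_2_1_A` for the section `σ ↦ n(ω_T(σ)) ⋊ σ` of `Ĝ ⋊ Γ`), used as hypotheses, never asserted; the Weil
group is an abstract surjection `π : W →* Γ` and χ-data are in the Weil dress ★ `KeyLemmasII.IsChiDataW` (module docstring
there).  `∀`-claims over all such data are made only where the printed argument is a formal computation in that data (said
in each docstring); Lemma 2.6.A and (2.6.4), whose printed proofs use the Tits section on all of `Ω ⋊ Γ` and Lemma 2.3.B,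
are AS-PRINTED PREDICATES on explicit data (precedent: ★ `LanglandsShelstad1987.Properties`, ★ `Liu2021.Prop413AsPrinted`:
a consumer assumes `(h : X data)` for ITS data; `∀ data, X data` is not claimed).

## Index (print item ↦ declaration)
| item (reissue page) | declaration(s) |
|---|---|
| (2.6) `(ℬ, 𝒯)`, `𝒯 ⊂ Ĝ`, `n(ω_T(σ))` (p. 23) | `DualTorusEmbedding`, `.IsTransport`, `.IsWeylCocycle` |
| admissible embedding `ξ(w) = r_p(w) n(ω_T(σ)) × w` (p. 23) | `DualTorusEmbedding.xiZero`, `.xiLeft`, `Par_2_6_isLHom` |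
| (2.6.1) change of `Γ`-splitting (p. 23) | `DualTorusEmbedding.conjBy`, `Remark_2_6_1` |
| (2.6.2) + **Lemma 2.6.A** (pp. 23–24) | `DualTorusEmbedding.ActsOnTorusAs`, `Lemma_2_6_A` |
| (2.6.3) change of χ-data `ξ ↦ c ⊗ ξ` (p. 24) | `Remark_2_6_3` |
| (2.6.4) transport by `Int g⁻¹` (p. 24) | `Remark_2_6_4` |
| (2.6.5) local–global (p. 25) | not typed: needs places ∕ completions of a number field acting on Weil groups (census line at the end) |
-/

noncomputable section

open scoped TensorProduct Pointwise

namespace Literature.NumberTheory.Automorphic.LanglandsShelstad1987.KeyLemmasII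

universe u v w u₁

/-! ## (2.6) A second application: admissible embeddings `ᴸT → ᴸG` (reissue pp. 22–25) -/

section SecondApplication

variable {Γ : Type u} [Group Γ] {X : Type v} [AddCommGroup X] [DistribMulAction Γ X]
variable {W : Type w} [Group W] (π : W →* Γ)
variable {Ĝ : Type u₁} [Group Ĝ] [MulDistribMulAction Γ Ĝ]

variable (Γ X Ĝ) in
/-- **Interface for (2.6)** (reissue p. 23).  Print: «Suppose that `G` is a connected reductive group defined over `F` …
`T` a maximal torus over `F` in `G` … There will be no harm in replacing `F` throughout by a finite Galois extension `L`
… over which `T` splits … Fix a `Γ`-splitting `(ℬ, 𝒯, {X_{α^∨}})` of `Ĝ`.  A homomorphism `ξ : ᴸT → ᴸG` is an admissible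
embedding if (i) `ξ` maps `T̂` to `𝒯` by the isomorphism attached to the pair `(ℬ, 𝒯)` and the choice of a Borel subgroup
`B` in `G` containing `T`, and (ii) `ξ(w) ∈ Ĝ × w`, `w ∈ W` … if `w → σ` under `W → Γ` then `Int ξ(w)` acts on `𝒯` as the
transport by `ξ` of the action of `σ ∈ Γ` on `T̂`. We write this transport `σ_T` as `ω_T(σ) ⋊ σ ∈ Ω × Γ` … By Lemma 2.1.A
`n(w) = n(ω_T(σ)) × w ∈ Norm(𝒯, Ĝ) × w` satisfies `n(w₁)n(w₂)n(w₁w₂)⁻¹ = t_p(σ₁, σ₂)`.»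
The tree has no dual group with maximal torus ∕ Weyl group ∕ the elements `n(ω)` of (2.1) (★ `Automorphic.LGroupData`
records only `Ĝ ≤ GL_N(ℂ)` with its `Γ_F`-action), so the (2.6) items are stated on THIS explicit datum, for `X = X^*(T)`
carrying the action `σ_T` (the `[DistribMulAction Γ X]` instance), `Ĝ` any group on which `Γ` acts by automorphisms
(`[MulDistribMulAction Γ Ĝ]`, the `L`-action fixing the `Γ`-splitting), `𝒯 = ℂ^× ⊗ X` (`UnitsTensor X ℂ`):
* `ι` — the inclusion `𝒯 ↪ Ĝ` composed with the identification `T̂ → 𝒯` of (i);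
* `nT σ` — the element `n(ω_T(σ)) ∈ Norm(𝒯, Ĝ)`.
Its printed properties are the predicates `IsTransport` and `IsWeylCocycle` below (hypotheses where used, never
asserted). [cite: LanglandsShelstad1987, §2.6 (reissue p. 23)] -/
structure DualTorusEmbedding where
  /-- `T̂ = ℂ^× ⊗ X^*(T) → 𝒯 ⊂ Ĝ`. -/
  ι : Multiplicative (UnitsTensor X ℂ) →* Ĝ
  /-- `σ ↦ n(ω_T(σ)) ∈ Norm(𝒯, Ĝ)`. -/
  nT : Γ → Ĝ

namespace DualTorusEmbedding

variable (D : DualTorusEmbedding Γ X Ĝ)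

/-- (2.6) (reissue p. 23): `ι` is injective and «`Int ξ(w)` acts on `𝒯` as the transport by `ξ` of the action of `σ` on
`T̂`», i.e. `Int n(ω_T(σ)) ∘ σ_Ĝ = σ_T` on `𝒯`: `n(ω_T(σ)) · σ(ι t) · n(ω_T(σ))⁻¹ = ι(σ_T t)`.
[cite: LanglandsShelstad1987, §2.6 (reissue p. 23)] -/
def IsTransport : Prop :=
  Function.Injective D.ι ∧
    ∀ (σ : Γ) (t : UnitsTensor X ℂ),
      D.nT σ * σ • D.ι (Multiplicative.ofAdd t) * (D.nT σ)⁻¹ = D.ι (Multiplicative.ofAdd (σ • t))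

/-- (2.6) (reissue p. 23): «By Lemma 2.1.A `n(w) = n(ω_T(σ)) × w` … satisfies `n(w₁)n(w₂)n(w₁w₂)⁻¹ = t_p(σ₁, σ₂)`, if
`w_i → σ_i` under `W → Γ`, where `p(α) = 1` if and only if `α^∨` is a root of `𝒯` in `ℬ`» — in `Ĝ ⋊ Γ` this reads
`n(ω_T(σ₁)) · σ₁(n(ω_T(σ₂))) · n(ω_T(σ₁σ₂))⁻¹ = ι(t_p(σ₁, σ₂))`, `t_p` = ★ `tCochain` for the action `σ_T` on the roots
`R = R(G, T) ⊂ X` and the `ℬ`-positivity gauge `p` — i.e. ★ `KeyLemmasI.Lemma_2_1_A` for the section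
`σ ↦ n(ω_T(σ)) ⋊ σ` of `Ĝ ⋊ Γ → Γ` (Mathlib `SemidirectProduct` for the `Γ`-action on `Ĝ`):
`(n(ω_T(σ₁)) ⋊ σ₁)(n(ω_T(σ₂)) ⋊ σ₂) = (ι t_p(σ₁,σ₂) ⋊ 1)(n(ω_T(σ₁σ₂)) ⋊ σ₁σ₂)`. [cite: LanglandsShelstad1987, §2.6 (reissue p. 23)] -/
def IsWeylCocycle (R : Finset X) (p : X → ℤˣ) : Prop :=
  KeyLemmasI.Lemma_2_1_A Γ X ℂ R p (Ĝ ⋊[MulDistribMulAction.toMulAut Γ Ĝ] Γ)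
    (SemidirectProduct.inl.comp D.ι) fun σ => ⟨D.nT σ, σ⟩

/-- **`ξ(w) = r_p(w) n(ω_T(σ)) × w`, `w ∈ W`** (reissue p. 23) — its `Ĝ`-component `ξ₀(w) = ι(r_p(w)) · n(ω_T(π w))`, for a
given 1-cochain `r_p : W → ℂ^× ⊗ X` (print: `r_p = s_{p/p₀} r_{p₀}` of (2.5) for the χ-data `{χ_α}`, i.e. ★ `rqCochain` ∕
★ `rCochainTotal` with `q = p`). [cite: LanglandsShelstad1987, §2.6 (reissue p. 23)] -/
def xiZero (r : W → UnitsTensor X ℂ) (w : W) : Ĝ := D.ι (Multiplicative.ofAdd (r w)) * D.nT (π w)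

/-- The `Ĝ`-component of `ξ(t × w) = ι(t) ξ₀(w) × w` on `ᴸT = T̂ ⋊ W` (reissue p. 23: an admissible embedding is
determined by `w ↦ ξ(w) = ξ₀(w) × w` together with (i)). [cite: LanglandsShelstad1987, §2.6 (reissue p. 23)] -/
def xiLeft (r : W → UnitsTensor X ℂ) (t : UnitsTensor X ℂ) (w : W) : Ĝ :=
  D.ι (Multiplicative.ofAdd t) * D.xiZero π r w

/-- «`g ∈ Norm(𝒯, Ĝ)` acts on `𝒯` as `μ`» (Lemma 2.6.A, reissue p. 24), `μ` given as an automorphism of `𝒯 = ℂ^× ⊗ X`.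
[cite: LanglandsShelstad1987, Lemma 2.6.A (reissue p. 24)] -/
def ActsOnTorusAs (g : Ĝ) (μ : UnitsTensor X ℂ ≃+ UnitsTensor X ℂ) : Prop :=
  ∀ t : UnitsTensor X ℂ, g * D.ι (Multiplicative.ofAdd t) * g⁻¹ = D.ι (Multiplicative.ofAdd (μ t))

/-- The datum obtained by replacing the `Γ`-splitting `(ℬ, 𝒯, {X_{α^∨}})` by its `g`-conjugate ((2.6.1), reissue p. 23:
«Then `n(w)` is replaced by `g⁻¹n(w)g`, `w ∈ W`, and `ξ : ᴸT → ᴸG` by `Int g⁻¹ · ξ`»).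
[cite: LanglandsShelstad1987, §2.6 (2.6.1) (reissue p. 23)] -/
def conjBy (g : Ĝ) : DualTorusEmbedding Γ X Ĝ where
  ι := (MulAut.conj g⁻¹).toMonoidHom.comp D.ι
  nT := fun σ => g⁻¹ * D.nT σ * g

end DualTorusEmbedding

/-- (2.6) (reissue p. 23): «Thus with `ξ(w) = r_p(w)n(ω_T(σ)) × w`, `w ∈ W` we obtain an admissible homomorphism
`ξ : ᴸT → ᴸG`» — `ξ(t × w) = ι(t)ξ₀(w) × w` is multiplicative on `ᴸT = T̂ ⋊ W` (`W` acting on `T̂` through `π` by `σ_T`),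
with values in `ᴸG = Ĝ ⋊ W` (`W` acting through `π`): `ξ(t₁ × w₁) · ξ(t₂ × w₂) = ξ(t₁σ₁(t₂) × w₁w₂)` on `Ĝ`-components,
GIVEN the transport property, the relation of Lemma 2.1.A for `n(ω_T(σ))` and the conclusion of Lemma 2.5.A
`∂r_p = t_p` (then `r_p⁻¹` splits `t_p`, as `t_p² = 1`).  A formal computation in this generality.
[cite: LanglandsShelstad1987, §2.6 (reissue p. 23)] -/
def Par_2_6_isLHom : Prop :=
  ∀ {Γ : Type u} [Group Γ] {X : Type v} [AddCommGroup X] [DistribMulAction Γ X] {W : Type w} [Group W]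
    (π : W →* Γ) {Ĝ : Type u₁} [Group Ĝ] [MulDistribMulAction Γ Ĝ] (D : DualTorusEmbedding Γ X Ĝ)
    (R : Finset X) (p : X → ℤˣ) (r : W → UnitsTensor X ℂ),
    D.IsTransport → D.IsWeylCocycle R p →
    (∀ v w : W, π v • r w - r (v * w) + r v = tCochain Γ ℂ R p (π v, π w)) →
    ∀ (t₁ t₂ : UnitsTensor X ℂ) (w₁ w₂ : W),
      D.xiLeft π r t₁ w₁ * π w₁ • D.xiLeft π r t₂ w₂ = D.xiLeft π r (t₁ + π w₁ • t₂) (w₁ * w₂)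

/-- **(2.6.1)** (reissue p. 23): «Suppose that the `Γ`-splitting is replaced by another, `(ℬ^g, 𝒯^g, {X_{α^∨}}^g)`. We may
suppose that `g ∈ Ĝ` is `Γ`-invariant [K2]. Then `n(w)` is replaced by `g⁻¹n(w)g`, `w ∈ W`, and `ξ : ᴸT → ᴸG` by
`Int g⁻¹ · ξ`, so that the `Ĝ`-conjugacy class of `ξ` is not affected»: for `Γ`-invariant `g`, the `ξ` of `D.conjBy g` is
`Int g⁻¹ ∘ ξ` (on `Ĝ`-components, `Int g⁻¹ (x × w) = g⁻¹ x w(g) × w = g⁻¹ x g × w`).  A formal computation.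
[cite: LanglandsShelstad1987, §2.6 (2.6.1) (reissue p. 23)] -/
def Remark_2_6_1 : Prop :=
  ∀ {Γ : Type u} [Group Γ] {X : Type v} [AddCommGroup X] [DistribMulAction Γ X] {W : Type w} [Group W]
    (π : W →* Γ) {Ĝ : Type u₁} [Group Ĝ] [MulDistribMulAction Γ Ĝ] (D : DualTorusEmbedding Γ X Ĝ)
    (r : W → UnitsTensor X ℂ) (g : Ĝ), (∀ σ : Γ, σ • g = g) →
    ∀ (t : UnitsTensor X ℂ) (w : W), (D.conjBy g).xiLeft π r t w = g⁻¹ * D.xiLeft π r t w * π w • g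

/-- **Lemma 2.6.A** (reissue p. 24), with (2.6.2) (p. 23): «We show now that the `Ĝ`-conjugacy class of `ξ` is independent
of the choice of `ℬ`. Suppose that `ℬ` is replaced by `ℬ′ = vℬv⁻¹`, where `v ∈ Norm(𝒯, Ĝ)`, and `ξ′` is obtained in place
of `ξ`. Let `μ` in `Ω = Ω(Ĝ, 𝒯)` be the element defined by the transport of `Int v|_𝒯` to `𝒯` by `ξ`. Then the transport of
`σ` from `T̂` to `𝒯` via `ξ′` is `σ_{T′} = ω′_T(σ) ⋊ σ`, where `ω′_T(σ) = μ⁻¹ω_T(σ)σ(μ)`.  **Lemma 2.6.A.** We have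
`ξ′ = Int g⁻¹ ∘ ξ`, where `g ∈ Norm(𝒯, Ĝ)` acts on `𝒯` as `μ`.»  AS-PRINTED PREDICATE on explicit data (the tree cannot
yet construct `ξ′` from `ℬ′`: that needs the elements `n(ω)`, `ω ∈ Ω ⋊ Γ`, of (2.1) and Lemmas 2.1.A ∕ 2.3.B, cf. ★
`KeyLemmasI`): `D`, `r` are the datum and cochain of `ξ` (for `ℬ`, gauge `p`, χ-data `{χ_α}`), `D′`, `r′` those of `ξ′`
(for `ℬ′`: `nT′ σ = n(μ⁻¹ω_T(σ)σ(μ))`, gauge `p ∘ μ⁻¹`, χ-data `{χ_{μα}}`, proof p. 24), `μ` the automorphism of `𝒯`;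
the predicate says: some `g ∈ Ĝ` acting on `𝒯` as `μ` conjugates `ξ` into `ξ′`.  A consumer assumes it for ITS data.
[cite: LanglandsShelstad1987, Lemma 2.6.A (reissue p. 24)] -/
def Lemma_2_6_A (D D' : DualTorusEmbedding Γ X Ĝ) (r r' : W → UnitsTensor X ℂ)
    (μ : UnitsTensor X ℂ ≃+ UnitsTensor X ℂ) : Prop :=
  ∃ g : Ĝ, D.ActsOnTorusAs g μ ∧
    ∀ (t : UnitsTensor X ℂ) (w : W), D'.xiLeft π r' t w = g⁻¹ * D.xiLeft π r t w * π w • g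

/-- **(2.6.3)** (reissue p. 24): «Suppose that the χ-data `{χ_α}` are replaced by `{χ′_α}`. Then `χ′_α = ζ_αχ_α`, where
`{ζ_α : α ∈ R}` satisfies the conditions of Corollary 2.5.B. Let `c` be the cocycle defined there. Then the embedding `ξ`
is replaced by `c ⊗ ξ` where `c ⊗ ξ(t × w) = c(w)ξ(t × w)`, `t × w ∈ ᴸT`.»  With the SAME choices (`Λ`, `y`, `v_0`, `v_1`)
for `χζ` and `χ`: `r_p[χζ] = r_p[χ] · c[ζ]`, hence `ξ[χζ](t × w) = ι(c(w)) ξ[χ](t × w)`; stated for `Γ` finite and `π`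
surjective (so that the orbit sums are finite), a formal consequence of the bilinearity of `a^λ`.
[cite: LanglandsShelstad1987, §2.6 (2.6.3) (reissue p. 24)] -/
def Remark_2_6_3 : Prop :=
  ∀ {Γ : Type u} [Group Γ] [Finite Γ] {X : Type v} [AddCommGroup X] [DistribMulAction Γ X] {W : Type w} [Group W]
    (π : W →* Γ), Function.Surjective π →
    ∀ {Ĝ : Type u₁} [Group Ĝ] [MulDistribMulAction Γ Ĝ] (D : DualTorusEmbedding Γ X Ĝ) (R Λ : Finset X)
    (p : X → ℤˣ) (χ ζ : X → W → ℂˣ) (y : (l : X) → W ⧸ pmW π l → W) (v₀ v₁ : X → W)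
    (t : UnitsTensor X ℂ) (w : W),
    D.xiLeft π (rCochainTotal π R Λ p (χ * ζ) y v₀ v₁) t w =
      D.ι (Multiplicative.ofAdd (cCochainTotal π Λ ζ y v₀ v₁ w)) * D.xiLeft π (rCochainTotal π R Λ p χ y v₀ v₁) t w

/-- **(2.6.4)** (reissue p. 24): «Suppose that `Int g⁻¹` maps `T` to `T′` over `F` and carries the χ-data `{χ_α}` for `T`
to data `{χ′_α}` for `T′`. Now `g` defines a canonical isomorphism `λ_g : ᴸT′ → ᴸT` … Then `ξ′ = ξ ∘ λ_g` is the embedding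
of `ᴸT′` in `ᴸG` defined by the Borel subgroup `B′ = g⁻¹Bg` of `G`. Thus the class of embeddings attached to `(T′, {χ′_α})`
is obtained from that attached to `(T, {χ_α})` by composition with the canonical `ᴸT′ → ᴸT`.»  AS-PRINTED PREDICATE:
`e : X′ ≃ X` the `Γ`-isomorphism of character lattices induced by `Int g⁻¹` (so `λ_g = e_* ⋊ id` on `T̂′ ⋊ W`), `D`, `r` the
datum of `ξ`, `D′`, `r′` that of `ξ′`; the predicate says `ξ′(t′ × w) = ξ(e_*t′ × w)` on `Ĝ`-components.
[cite: LanglandsShelstad1987, §2.6 (2.6.4) (reissue p. 24)] -/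
def Remark_2_6_4 {X' : Type v} [AddCommGroup X'] [DistribMulAction Γ X'] (e : X' ≃+ X)
    (D : DualTorusEmbedding Γ X Ĝ) (D' : DualTorusEmbedding Γ X' Ĝ) (r : W → UnitsTensor X ℂ)
    (r' : W → UnitsTensor X' ℂ) : Prop :=
  ∀ (t' : UnitsTensor X' ℂ) (w : W),
    D'.xiLeft π r' t' w = D.xiLeft π r (TensorProduct.map e.toAddMonoidHom.toIntLinearMap LinearMap.id t') w

/- (2.6.5) (reissue p. 25), the local–global compatibility `ξ_v(w_v) = ξ(w)` for `W_v → W` over a place `v` of a number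
field, is NOT typed here: it needs completions of a number field acting compatibly on Weil groups and on the fields
`F_{+λ}`, `F_{±λ}` — census line only (SPLIT-v1 row TN-t02: remarks as cross-refs). -/

end SecondApplication

/-! ## Discharges (proof lane; statements above untouched) -/

section Discharges

/-- Discharge of `Par_2_6_isLHom` (reissue p. 23, «we obtain an admissible homomorphism»): the formal computation
`ι(t₁)ι(r₁)n₁ · σ₁(ι(t₂)ι(r₂)n₂) = ι(t₁ + σ₁t₂ + σ₁r₂ + r₁ + t_p) n₁₂`, using the transport property twice, the relation of
Lemma 2.1.A once, `∂r = t_p` and `2·t_p = 0` in `ℂ^× ⊗ X`. [cite: LanglandsShelstad1987, §2.6 (reissue p. 23)] -/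
theorem Par_2_6_isLHom_holds : Par_2_6_isLHom := by
  intro Γ _ X _ _ W _ π Ĝ _ _ D R p r hT hW hr t₁ t₂ w₁ w₂
  obtain ⟨-, hT⟩ := hT
  have hTr : ∀ (σ : Γ) (x : UnitsTensor X ℂ),
      D.nT σ * σ • D.ι (Multiplicative.ofAdd x) = D.ι (Multiplicative.ofAdd (σ • x)) * D.nT σ := by
    intro σ x
    have h := hT σ x
    rw [mul_inv_eq_iff_eq_mul] at h
    exact h
  have hWl : ∀ θ₁ θ₂ : Γ, D.nT θ₁ * θ₁ • D.nT θ₂ =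
      D.ι (Multiplicative.ofAdd (tCochain Γ ℂ R p (θ₁, θ₂))) * D.nT (θ₁ * θ₂) := by
    intro θ₁ θ₂
    have h := congrArg SemidirectProduct.left (hW θ₁ θ₂)
    simpa [SemidirectProduct.mul_left] using h
  have h2 : ∀ x : Γ × Γ, tCochain Γ ℂ R p x + tCochain Γ ℂ R p x = 0 := by
    intro x
    simp only [tCochain, ← Finset.sum_add_distrib, unitPow, ← TensorProduct.tmul_add, ← ofMul_mul]
    simp
  have hneg : -tCochain Γ ℂ R p (π w₁, π w₂) = tCochain Γ ℂ R p (π w₁, π w₂) :=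
    neg_eq_iff_add_eq_zero.mpr (h2 _)
  have hr' : r (w₁ * w₂) = π w₁ • r w₂ + r w₁ + tCochain Γ ℂ R p (π w₁, π w₂) := by
    have h := hr w₁ w₂
    rw [← hneg, ← sub_eq_add_neg, ← h]
    abel
  have hc : ∀ a b : Multiplicative (UnitsTensor X ℂ), D.ι a * D.ι b = D.ι b * D.ι a := fun a b => by
    rw [← map_mul, mul_comm, map_mul]
  simp only [DualTorusEmbedding.xiLeft, DualTorusEmbedding.xiZero, map_mul, hr', ofAdd_add, smul_mul']
  simp only [mul_assoc]
  rw [← mul_assoc (D.nT (π w₁)) (π w₁ • D.ι (Multiplicative.ofAdd t₂)), hTr, mul_assoc,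
    ← mul_assoc (D.nT (π w₁)) (π w₁ • D.ι (Multiplicative.ofAdd (r w₂))), hTr, mul_assoc, hWl,
    ← mul_assoc (D.ι (Multiplicative.ofAdd (r w₁))) (D.ι (Multiplicative.ofAdd (π w₁ • t₂))),
    hc (Multiplicative.ofAdd (r w₁)) (Multiplicative.ofAdd (π w₁ • t₂)), mul_assoc,
    ← mul_assoc (D.ι (Multiplicative.ofAdd (r w₁))) (D.ι (Multiplicative.ofAdd (π w₁ • r w₂))),
    hc (Multiplicative.ofAdd (r w₁)) (Multiplicative.ofAdd (π w₁ • r w₂)), mul_assoc]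

/-- Discharge of `Remark_2_6_1` ((2.6.1), reissue p. 23): conjugating the splitting by a `Γ`-invariant `g` conjugates `ξ`.
[cite: LanglandsShelstad1987, §2.6 (2.6.1) (reissue p. 23)] -/
theorem Remark_2_6_1_holds : Remark_2_6_1 := by
  intro Γ _ X _ _ W _ π Ĝ _ _ D r g hg t w
  simp only [DualTorusEmbedding.xiLeft, DualTorusEmbedding.xiZero, DualTorusEmbedding.conjBy,
    MonoidHom.coe_comp, Function.comp_apply, MulEquiv.coe_toMonoidHom, MulAut.conj_apply, inv_inv, hg]
  simp only [mul_assoc, mul_inv_cancel_left]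

/-- Discharge of `Remark_2_6_3` ((2.6.3), reissue p. 24): `r_p[χζ] = r_p[χ] + c[ζ]` orbit by orbit (bilinearity of `a^λ` and
`finsum_add_distrib` over the finite `W ⧸ W_{±λ}` — finite because `Γ` is finite and `π` surjective), then commutativity of
the `ι`-image. [cite: LanglandsShelstad1987, §2.6 (2.6.3) (reissue p. 24)] -/
theorem Remark_2_6_3_holds : Remark_2_6_3 := by
  intro Γ _ _ X _ _ W _ π hπ Ĝ _ _ D R Λ p χ ζ y v₀ v₁ t w
  -- finiteness of the coset spaces `W ⧸ W_{±λ}`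
  have hfin : ∀ l : X, Finite (W ⧸ pmW π l) := by
    intro l
    haveI : (pmW π l).FiniteIndex := by
      refine ⟨?_⟩
      rw [pmW, Subgroup.index_comap_of_surjective _ hπ]
      exact Subgroup.index_ne_zero_of_finite
    infer_instance
  -- `r_p[χζ] = r_p[χ] + c[ζ]` orbit by orbit
  have hsplit : ∀ l : X, ∀ w' : W,
      rCochain π l (χ * ζ) (y l) (v₀ l) (v₁ l) w' =
        rCochain π l χ (y l) (v₀ l) (v₁ l) w' + cCochain π l ζ (y l) (v₀ l) (v₁ l) w' := by
    intro l w'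
    haveI := hfin l
    simp only [rCochain, cCochain, sFun, Pi.mul_apply, unitPow, ofMul_mul, TensorProduct.tmul_add]
    exact finsum_add_distrib (Set.toFinite _) (Set.toFinite _)
  have htot : rCochainTotal π R Λ p (χ * ζ) y v₀ v₁ w =
      rCochainTotal π R Λ p χ y v₀ v₁ w + cCochainTotal π Λ ζ y v₀ v₁ w := by
    simp only [rCochainTotal, cCochainTotal, rqCochain, hsplit, ← Finset.sum_add_distrib, add_assoc]
  have hc : ∀ a b : Multiplicative (UnitsTensor X ℂ), D.ι a * D.ι b = D.ι b * D.ι a := fun a b => by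
    rw [← map_mul, mul_comm, map_mul]
  simp only [DualTorusEmbedding.xiLeft, DualTorusEmbedding.xiZero, htot, ofAdd_add, map_mul]
  simp only [← mul_assoc]
  rw [hc (Multiplicative.ofAdd t) (Multiplicative.ofAdd (rCochainTotal π R Λ p χ y v₀ v₁ w)),
    mul_assoc (D.ι (Multiplicative.ofAdd (rCochainTotal π R Λ p χ y v₀ v₁ w))),
    hc (Multiplicative.ofAdd t) (Multiplicative.ofAdd (cCochainTotal π Λ ζ y v₀ v₁ w)), ← mul_assoc,
    hc (Multiplicative.ofAdd (rCochainTotal π R Λ p χ y v₀ v₁ w))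
      (Multiplicative.ofAdd (cCochainTotal π Λ ζ y v₀ v₁ w)),
    mul_assoc (D.ι (Multiplicative.ofAdd (cCochainTotal π Λ ζ y v₀ v₁ w))),
    hc (Multiplicative.ofAdd (rCochainTotal π R Λ p χ y v₀ v₁ w)) (Multiplicative.ofAdd t)]
  simp only [mul_assoc]

end Discharges

end Literature.NumberTheory.Automorphic.LanglandsShelstad1987.KeyLemmasII

end
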